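import Summits.HubbardSuperconductivity.HubbardSuperconductivity.Theorems.WeakCouplingBCSKlLindhardEnclosureCellSound

/-!
# KL-MARGIN-SCAN reader (22) «kernel-lindhard-enclosure» — RECORDS SOUNDNESS, layer 3c: slope and hyperbola records, the `a`-grid, per-coordinate cosine ranges

More records-level facts under the three curved-cell rules: (§1) the slope records `sDnZ a / 2^40 ≤ S(a/2^40) ≤ sUpZ a / 2^40`
(`S(α) = 2 + 4t′α`, Gate §5 `slopeS`), `sPos a ⇒ 0 < S`, the affine min/max bounds of `S` on an interval, and `t′μ < 1` for admissible `P`;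
(§2) the Fermi hyperbola records `bStarDnZ a / 2^40 ≤ b⋆(a/2^40) ≤ bStarUpZ a / 2^40` (`b⋆(α) = −(2α+μ)/S(α)`, Gate §5 `bStar`) and the
ANTITONICITY of `b⋆` where `S > 0` (from `t′μ < 1`); (§3) the integer partition `linGridZ` (endpoints, monotonicity, membership); (§4) the four
per-coordinate cosine ranges of a guarded cell inside the root square on CLOSED coordinate intervals (`cell_cosx_mem`, `cell_cosx'_mem`,
`cell_cosy_mem`, `cell_cosy'_mem`: the cell data `aLo..bUp'` enclose `cos` of the plain and shifted coordinates).  Honest framing: elementary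
facts about the landed kernel definitions; nothing in this file asserts a KL margin at any `t′ ≠ 0`, `K₃`, `U₀`, the window or B1g
dominance; a Kohn–Luttinger instability statement is not ODLRO and nothing here proves superconductivity in the Hubbard model.
(p1 g26, 2026-08-29.)
-/

noncomputable section

set_option linter.dupNamespace false

namespace Summit.HubbardSuperconductivity.HubbardSuperconductivity.Theorems.KlLindhardEnclosure

open Real Set MeasureTheory Literature.MathematicalPhysics.QuantumLattice
open Summit.HubbardSuperconductivity.HubbardSuperconductivity.Theorems

/-! ## §1 The slope records -/

/-- `sDnZ a / 2^40 ≤ S(a/2^40)`. -/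
theorem Params.sDnZ_le (P : Params) (htpD : 0 < P.tpD) (a : ℤ) :
    ((P.sDnZ a : ℤ) : ℝ) / 2 ^ 40 ≤ slopeS ((P.tpN : ℝ) / (P.tpD : ℝ)) ((a : ℝ) / 2 ^ 40) := by
  have h := fdivZ_le_div (2 * D * P.tpD + 4 * P.tpN * a) P.tpD htpD
  have h' := (Rat.cast_le (K := ℝ)).mpr h
  have htpD' : (0 : ℝ) < (P.tpD : ℝ) := by exact_mod_cast htpD
  simp only [Params.sDnZ] at h' ⊢
  push_cast [D] at h'
  rw [div_le_iff₀ (by positivity)]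
  refine h'.trans (le_of_eq ?_)
  unfold slopeS
  field_simp
  ring

/-- `S(a/2^40) ≤ sUpZ a / 2^40`. -/
theorem Params.le_sUpZ (P : Params) (htpD : 0 < P.tpD) (a : ℤ) :
    slopeS ((P.tpN : ℝ) / (P.tpD : ℝ)) ((a : ℝ) / 2 ^ 40) ≤ ((P.sUpZ a : ℤ) : ℝ) / 2 ^ 40 := by
  have h := div_le_cdivZ (2 * D * P.tpD + 4 * P.tpN * a) P.tpD htpD
  have h' := (Rat.cast_le (K := ℝ)).mpr h
  have htpD' : (0 : ℝ) < (P.tpD : ℝ) := by exact_mod_cast htpD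
  simp only [Params.sUpZ] at h' ⊢
  push_cast [D] at h'
  rw [le_div_iff₀ (by positivity)]
  refine le_trans (le_of_eq ?_) h'
  unfold slopeS
  field_simp
  ring

/-- `sPos a ⇒ 0 < S(a/2^40)`. -/
theorem Params.sPos_real (P : Params) (htpD : 0 < P.tpD) {a : ℤ} (h : P.sPos a = true) :
    0 < slopeS ((P.tpN : ℝ) / (P.tpD : ℝ)) ((a : ℝ) / 2 ^ 40) := by
  simp only [Params.sPos, D, decide_eq_true_eq] at h
  have h' : (0 : ℝ) < 2 * 2 ^ 40 * (P.tpD : ℝ) + 4 * (P.tpN : ℝ) * (a : ℝ) := by exact_mod_cast h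
  have htpD' : (0 : ℝ) < (P.tpD : ℝ) := by exact_mod_cast htpD
  have e : slopeS ((P.tpN : ℝ) / (P.tpD : ℝ)) ((a : ℝ) / 2 ^ 40) = (2 * 2 ^ 40 * (P.tpD : ℝ) + 4 * (P.tpN : ℝ) * (a : ℝ)) / (2 ^ 40 * (P.tpD : ℝ)) := by
    unfold slopeS; field_simp
  rw [e]; positivity

/-- The slope is affine: on `[lo, hi]` it lies between its endpoint values. -/
theorem slopeS_between (t : ℝ) {lo hi a : ℝ} (h0 : lo ≤ a) (h1 : a ≤ hi) :
    min (slopeS t lo) (slopeS t hi) ≤ slopeS t a ∧ slopeS t a ≤ max (slopeS t lo) (slopeS t hi) := by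
  unfold slopeS
  rcases le_total 0 t with ht | ht
  · have e1 : 2 + 4 * t * lo ≤ 2 + 4 * t * a := by nlinarith
    have e2 : 2 + 4 * t * a ≤ 2 + 4 * t * hi := by nlinarith
    exact ⟨(min_le_left _ _).trans e1, e2.trans (le_max_right _ _)⟩
  · have e1 : 2 + 4 * t * hi ≤ 2 + 4 * t * a := by nlinarith
    have e2 : 2 + 4 * t * a ≤ 2 + 4 * t * lo := by nlinarith
    exact ⟨(min_le_right _ _).trans e1, e2.trans (le_max_left _ _)⟩

/-- Positivity of the slope on `[lo, hi]` from positivity at the two ends. -/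
theorem slopeS_pos_between (t : ℝ) {lo hi a : ℝ} (hlo : 0 < slopeS t lo) (hhi : 0 < slopeS t hi) (h0 : lo ≤ a) (h1 : a ≤ hi) :
    0 < slopeS t a :=
  lt_of_lt_of_le (lt_min hlo hhi) (slopeS_between t h0 h1).1

/-- Admissible ⇒ `t′μ < 1` (real form). -/
theorem Params.tmu_lt_one (P : Params) (hP : P.admissible = true) :
    (P.tpN : ℝ) / (P.tpD : ℝ) * ((P.muN : ℝ) / (P.muD : ℝ)) < 1 := by
  obtain ⟨htpD, hmuD, -, -, -⟩ := P.admissible_facts hP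
  have h : P.tpN * P.muN < P.tpD * P.muD := by
    simp only [Params.admissible, Bool.and_eq_true, decide_eq_true_eq] at hP; exact hP.1.1.1.1.1.1.1.2
  have h' : (P.tpN : ℝ) * (P.muN : ℝ) < (P.tpD : ℝ) * (P.muD : ℝ) := by exact_mod_cast h
  have htpD' : (0 : ℝ) < (P.tpD : ℝ) := by exact_mod_cast htpD
  have hmuD' : (0 : ℝ) < (P.muD : ℝ) := by exact_mod_cast hmuD
  rw [div_mul_div_comm, div_lt_one (by positivity)]
  exact h'

/-! ## §2 The hyperbola records and the antitonicity of `b⋆` -/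

/-- The exact value: `2^40 · b⋆(a/2^40) = −(2a·muD + muN·D)·tpD·D / (muD·(2D·tpD + 4·tpN·a))` when `S > 0`. -/
theorem Params.bStar_cast (P : Params) (htpD : 0 < P.tpD) (hmuD : 0 < P.muD) {a : ℤ} (hs : P.sPos a = true) :
    2 ^ 40 * bStar ((P.tpN : ℝ) / (P.tpD : ℝ)) ((P.muN : ℝ) / (P.muD : ℝ)) ((a : ℝ) / 2 ^ 40) =
      ((-(2 * a * P.muD + P.muN * D) * P.tpD * D : ℤ) : ℝ) / ((P.muD * (2 * D * P.tpD + 4 * P.tpN * a) : ℤ) : ℝ) := by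
  simp only [Params.sPos, D, decide_eq_true_eq] at hs
  have hs' : (0 : ℝ) < 2 * 2 ^ 40 * (P.tpD : ℝ) + 4 * (P.tpN : ℝ) * (a : ℝ) := by exact_mod_cast hs
  have htpD' : (0 : ℝ) < (P.tpD : ℝ) := by exact_mod_cast htpD
  have hmuD' : (0 : ℝ) < (P.muD : ℝ) := by exact_mod_cast hmuD
  have hS : slopeS ((P.tpN : ℝ) / (P.tpD : ℝ)) ((a : ℝ) / 2 ^ 40) = (2 * 2 ^ 40 * (P.tpD : ℝ) + 4 * (P.tpN : ℝ) * (a : ℝ)) / (2 ^ 40 * (P.tpD : ℝ)) := by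
    unfold slopeS; field_simp
  unfold bStar
  rw [hS]
  push_cast [D]
  field_simp
  ring

/-- `bStarDnZ a / 2^40 ≤ b⋆(a/2^40)` (for `S > 0`). -/
theorem Params.bStarDnZ_le (P : Params) (htpD : 0 < P.tpD) (hmuD : 0 < P.muD) {a : ℤ} (hs : P.sPos a = true) :
    ((P.bStarDnZ a : ℤ) : ℝ) / 2 ^ 40 ≤ bStar ((P.tpN : ℝ) / (P.tpD : ℝ)) ((P.muN : ℝ) / (P.muD : ℝ)) ((a : ℝ) / 2 ^ 40) := by
  have hden : 0 < P.muD * (2 * D * P.tpD + 4 * P.tpN * a) := by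
    simp only [Params.sPos, decide_eq_true_eq] at hs; exact mul_pos hmuD hs
  have h := fdivZ_le_div (-(2 * a * P.muD + P.muN * D) * P.tpD * D) (P.muD * (2 * D * P.tpD + 4 * P.tpN * a)) hden
  have h' := (Rat.cast_le (K := ℝ)).mpr h
  simp only [Rat.cast_div, Rat.cast_intCast] at h'
  rw [div_le_iff₀ (by positivity), mul_comm, P.bStar_cast htpD hmuD hs]
  exact h'

/-- `b⋆(a/2^40) ≤ bStarUpZ a / 2^40` (for `S > 0`). -/
theorem Params.le_bStarUpZ (P : Params) (htpD : 0 < P.tpD) (hmuD : 0 < P.muD) {a : ℤ} (hs : P.sPos a = true) :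
    bStar ((P.tpN : ℝ) / (P.tpD : ℝ)) ((P.muN : ℝ) / (P.muD : ℝ)) ((a : ℝ) / 2 ^ 40) ≤ ((P.bStarUpZ a : ℤ) : ℝ) / 2 ^ 40 := by
  have hden : 0 < P.muD * (2 * D * P.tpD + 4 * P.tpN * a) := by
    simp only [Params.sPos, decide_eq_true_eq] at hs; exact mul_pos hmuD hs
  have h := div_le_cdivZ (-(2 * a * P.muD + P.muN * D) * P.tpD * D) (P.muD * (2 * D * P.tpD + 4 * P.tpN * a)) hden
  have h' := (Rat.cast_le (K := ℝ)).mpr h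
  simp only [Rat.cast_div, Rat.cast_intCast] at h'
  rw [le_div_iff₀ (by positivity), mul_comm, P.bStar_cast htpD hmuD hs]
  exact h'

/-- **`b⋆` IS ANTITONE where the slope is positive** (`t′μ < 1`): `a ≤ a' ⇒ b⋆(a') ≤ b⋆(a)`. -/
theorem bStar_le_bStar {t μ a a' : ℝ} (htμ : t * μ < 1) (hS : 0 < slopeS t a) (hS' : 0 < slopeS t a') (h : a ≤ a') :
    bStar t μ a' ≤ bStar t μ a := by
  unfold bStar
  rw [div_le_div_iff₀ hS' hS]
  unfold slopeS at hS hS' ⊢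
  nlinarith [mul_nonneg (sub_nonneg.2 h) (sub_pos.2 htμ).le]

/-! ## §3 The integer partition `linGridZ` -/

/-- The first grid point is `u0`. -/
theorem linGridZ_zero (u0 u1 : ℤ) (M : ℕ) : linGridZ u0 u1 M 0 = u0 := by
  simp [linGridZ, fdivZ]

/-- The last grid point is `u1`. -/
theorem linGridZ_last (u0 u1 : ℤ) {M : ℕ} (hM : 0 < M) : linGridZ u0 u1 M M = u1 := by
  have hM' : (M : ℤ) ≠ 0 := by exact_mod_cast hM.ne'
  simp only [linGridZ, fdivZ]
  rw [Int.mul_ediv_cancel _ hM']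
  ring

/-- The grid is monotone in the index (for `u0 ≤ u1`). -/
theorem linGridZ_mono {u0 u1 : ℤ} (h : u0 ≤ u1) {M : ℕ} (hM : 0 < M) {m m' : ℕ} (hmm : m ≤ m') :
    linGridZ u0 u1 M m ≤ linGridZ u0 u1 M m' := by
  simp only [linGridZ, fdivZ]
  have : (m : ℤ) ≤ (m' : ℤ) := by exact_mod_cast hmm
  have hnum : (u1 - u0) * (m : ℤ) ≤ (u1 - u0) * (m' : ℤ) := by nlinarith
  have := Int.ediv_le_ediv (by exact_mod_cast hM : (0 : ℤ) < (M : ℤ)) hnum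
  linarith

/-- Every grid point with index `≤ M` lies in `[u0, u1]` (for `u0 ≤ u1`). -/
theorem linGridZ_mem {u0 u1 : ℤ} (h : u0 ≤ u1) {M : ℕ} (hM : 0 < M) {m : ℕ} (hm : m ≤ M) :
    u0 ≤ linGridZ u0 u1 M m ∧ linGridZ u0 u1 M m ≤ u1 := by
  constructor
  · have := linGridZ_mono h hM (Nat.zero_le m); rwa [linGridZ_zero] at this
  · have := linGridZ_mono h hM hm; rwa [linGridZ_last u0 u1 hM] at this

/-! ## §4 Per-coordinate cosine ranges of a guarded cell (closed coordinate intervals) -/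

/-- **ABSCISSA RANGE**: for `x ∈ [a/U, b/U]` (cell inside the root square), `aLo/2^40 ≤ cos x ≤ aUp/2^40`. -/
theorem Params.cell_cosx_mem (P : Params) (hP : P.admissible = true) {a b c d : ℤ} (ha : -P.Xz ≤ a) (hb : b ≤ P.Xz)
    {x : ℝ} (hx0 : (a : ℝ) / (P.U : ℝ) ≤ x) (hx1 : x ≤ (b : ℝ) / (P.U : ℝ)) :
    (((P.cell (P.mkX a) (P.mkX b) (P.mkY c) (P.mkY d)).aLo : ℤ) : ℝ) / 2 ^ 40 ≤ Real.cos x ∧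
    Real.cos x ≤ (((P.cell (P.mkX a) (P.mkX b) (P.mkY c) (P.mkY d)).aUp : ℤ) : ℝ) / 2 ^ 40 := by
  obtain ⟨-, -, hU, hq1, -⟩ := P.admissible_facts hP
  have hq := abs_nonneg P.q1z
  have h1 := P.cosInfZ_le hP (P.mkX_lo_le hU a) (P.mkX_lo_le hU b) hx0 hx1
  have h2 := P.le_cosSupZ hP (P.le_mkX_hi hU a) (P.le_mkX_hi hU b) (by omega) (by omega) hx0 hx1
  simpa [Params.cell, Params.mkX_z, Params.mkY_z] using And.intro h1 h2

/-- **SHIFTED ABSCISSA RANGE**: for `x ∈ [a/U, b/U]`, `aLo'/2^40 ≤ cos (x + q₁/U) ≤ aUp'/2^40`. -/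
theorem Params.cell_cosx'_mem (P : Params) (hP : P.admissible = true) {a b c d : ℤ} (ha : -P.Xz ≤ a) (hb : b ≤ P.Xz)
    {x : ℝ} (hx0 : (a : ℝ) / (P.U : ℝ) ≤ x) (hx1 : x ≤ (b : ℝ) / (P.U : ℝ)) :
    (((P.cell (P.mkX a) (P.mkX b) (P.mkY c) (P.mkY d)).aLo' : ℤ) : ℝ) / 2 ^ 40 ≤ Real.cos (x + (P.q1z : ℝ) / (P.U : ℝ)) ∧
    Real.cos (x + (P.q1z : ℝ) / (P.U : ℝ)) ≤ (((P.cell (P.mkX a) (P.mkX b) (P.mkY c) (P.mkY d)).aUp' : ℤ) : ℝ) / 2 ^ 40 := by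
  obtain ⟨-, -, hU, hq1, -⟩ := P.admissible_facts hP
  have hU' : (0 : ℝ) < (P.U : ℝ) := by exact_mod_cast hU
  have hqa := le_abs_self P.q1z
  have hqb := neg_abs_le P.q1z
  have h0 : ((a + P.q1z : ℤ) : ℝ) / (P.U : ℝ) ≤ x + (P.q1z : ℝ) / (P.U : ℝ) := by push_cast; rw [add_div]; linarith
  have h1' : x + (P.q1z : ℝ) / (P.U : ℝ) ≤ ((b + P.q1z : ℤ) : ℝ) / (P.U : ℝ) := by push_cast; rw [add_div]; linarith
  have h1 := P.cosInfZ_le hP (P.mkX_lo'_le hU a) (P.mkX_lo'_le hU b) h0 h1'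
  have h2 := P.le_cosSupZ hP (P.le_mkX_hi' hU a) (P.le_mkX_hi' hU b) (by omega) (by omega) h0 h1'
  simpa [Params.cell, Params.mkX_z, Params.mkY_z] using And.intro h1 h2

/-- **ORDINATE RANGE**: for `y ∈ [c/U, d/U]`, `bLo/2^40 ≤ cos y ≤ bUp/2^40`. -/
theorem Params.cell_cosy_mem (P : Params) (hP : P.admissible = true) {a b c d : ℤ} (hc : -P.Xz ≤ c) (hd : d ≤ P.Xz)
    {y : ℝ} (hy0 : (c : ℝ) / (P.U : ℝ) ≤ y) (hy1 : y ≤ (d : ℝ) / (P.U : ℝ)) :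
    (((P.cell (P.mkX a) (P.mkX b) (P.mkY c) (P.mkY d)).bLo : ℤ) : ℝ) / 2 ^ 40 ≤ Real.cos y ∧
    Real.cos y ≤ (((P.cell (P.mkX a) (P.mkX b) (P.mkY c) (P.mkY d)).bUp : ℤ) : ℝ) / 2 ^ 40 := by
  obtain ⟨-, -, hU, -, hq2⟩ := P.admissible_facts hP
  have hq := abs_nonneg P.q2z
  have h1 := P.cosInfZ_le hP (P.mkY_lo_le hU c) (P.mkY_lo_le hU d) hy0 hy1
  have h2 := P.le_cosSupZ hP (P.le_mkY_hi hU c) (P.le_mkY_hi hU d) (by omega) (by omega) hy0 hy1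
  simpa [Params.cell, Params.mkX_z, Params.mkY_z] using And.intro h1 h2

/-- **SHIFTED ORDINATE RANGE**: for `y ∈ [c/U, d/U]`, `bLo'/2^40 ≤ cos (y + q₂/U) ≤ bUp'/2^40`. -/
theorem Params.cell_cosy'_mem (P : Params) (hP : P.admissible = true) {a b c d : ℤ} (hc : -P.Xz ≤ c) (hd : d ≤ P.Xz)
    {y : ℝ} (hy0 : (c : ℝ) / (P.U : ℝ) ≤ y) (hy1 : y ≤ (d : ℝ) / (P.U : ℝ)) :
    (((P.cell (P.mkX a) (P.mkX b) (P.mkY c) (P.mkY d)).bLo' : ℤ) : ℝ) / 2 ^ 40 ≤ Real.cos (y + (P.q2z : ℝ) / (P.U : ℝ)) ∧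
    Real.cos (y + (P.q2z : ℝ) / (P.U : ℝ)) ≤ (((P.cell (P.mkX a) (P.mkX b) (P.mkY c) (P.mkY d)).bUp' : ℤ) : ℝ) / 2 ^ 40 := by
  obtain ⟨-, -, hU, -, hq2⟩ := P.admissible_facts hP
  have hU' : (0 : ℝ) < (P.U : ℝ) := by exact_mod_cast hU
  have hqa := le_abs_self P.q2z
  have hqb := neg_abs_le P.q2z
  have h0 : ((c + P.q2z : ℤ) : ℝ) / (P.U : ℝ) ≤ y + (P.q2z : ℝ) / (P.U : ℝ) := by push_cast; rw [add_div]; linarith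
  have h1' : y + (P.q2z : ℝ) / (P.U : ℝ) ≤ ((d + P.q2z : ℤ) : ℝ) / (P.U : ℝ) := by push_cast; rw [add_div]; linarith
  have h1 := P.cosInfZ_le hP (P.mkY_lo'_le hU c) (P.mkY_lo'_le hU d) h0 h1'
  have h2 := P.le_cosSupZ hP (P.le_mkY_hi' hU c) (P.le_mkY_hi' hU d) (by omega) (by omega) h0 h1'
  simpa [Params.cell, Params.mkX_z, Params.mkY_z] using And.intro h1 h2

end Summit.HubbardSuperconductivity.HubbardSuperconductivity.Theorems.KlLindhardEnclosure

end
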